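import Mathlib
import Literature.Analysis.FluidPDE.VectorCalculus
import Summits.NavierStokesRegularity.NavierStokesRegularity.Theorems.ThreadingFluxErtelTowerAffineConjugation
import Summits.NavierStokesRegularity.NavierStokesRegularity.Theorems.ThreadingFluxErtelTowerStrainShadowClassification
import Summits.NavierStokesRegularity.NavierStokesRegularity.Theorems.ThreadingFluxErtelTowerStrainShadowSurvivor
import Summits.NavierStokesRegularity.NavierStokesRegularity.Theorems.ThreadingFluxCentreJetTriaxialFrame
import Literature.Analysis.FluidPDE.CurlIsometryCovariance
import Literature.Analysis.Calculus.LiouvilleDeterminant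
import Literature.LinearAlgebra.Matrix.CommutingRotations
import HarnessLib

/-!
# Crux `PoloidalLiouville` (stmt-NavierStokesRegularity-1222, W1), crux idea «radial-jerk-tower» (ns-idea-15 g7):
# THE STRAIN SHADOW, FRAME-FREE — arbitrary triaxial strain `S`, arbitrary centre `x₀`

Support file (`--supports stmt-NavierStokesRegularity-1222`, helper).  Experiment cell `ns-wall-extremal`, width hand
ns-wall-eng-5 g8, item (α) «FRAME-FREE STRAIN SHADOW» (the free successor item of eng-5 g7; critic of record
ns-wall-crit-1 g5, batch #24 / 08:31:10Z: size M, no strike).  0 kit.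

The Defs twin `ThreadingFluxErtelTowerDefs` (p692432) and the landed proofs state the strain shadow in the STANDARD FRAME
(`S = diag(a,b,c)`, centre `0`).  Here the same statements are proved for an ARBITRARY strain `S : ℝ³ →L[ℝ] ℝ³` given with
an orthonormal eigenframe `u : Fin 3 → ℝ³` and pairwise distinct principal rates `e : Fin 3 → ℝ` (`Function.Injective e`,
`S (u i) = e i • u i`) — the TRIAXIAL VOCABULARY of `ThreadingFluxCentreJetDefs` (L1 `TriaxialToroidalJetRigidity`) — and an
ARBITRARY centre `x₀` (drift `S(x − x₀)`, sphere tangency `⟪B, x − x₀⟫ = 0`), i.e. in the form in which they apply AT AN ACTUAL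
TRIAXIAL STAGNATION CENTRE of a flow:

* `inviscidStrainRigidity_frame` — no non-zero field frozen into the strain stays tangent to the spheres about the centre
  (from `inviscidStrainRigidity`, p694495);
* ★ `strainShadowClassification_frame` — for `ν > 0` and `∑ e = 0`, every smooth divergence-free sphere-tangent solution of
  `∂ₜB + (S(x−x₀)·∇)B − SB = νΔB` on a preconnected open `I × U` is
  `B(t,x) = C · exp(⟪x−x₀, S(x−x₀)⟫ / 2ν) · (S(x−x₀) × (x−x₀))` for ONE constant `C`
  (from `strainShadowClassification`, p705922);
* ★ `strainShadowLiouville_frame` — in the bounded class on `I × ℝ³` such a field vanishes (from `strainShadowLiouville`);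
* `strainShadowSurvivor_frame` — conversely every member of that one-parameter family IS a steady solution, divergence free and
  sphere-tangent (from `strainShadowSurvivor`, p695047): boundedness stays load-bearing in every frame;
* `exists_eigenframe_of_isSymmetric` + `strainShadowLiouville_symmetric` / `strainShadowClassification_symmetric` — the same
  with the INTRINSIC hypotheses «`S` symmetric, every eigenvalue simple (`finrank (eigenspace S μ) ≤ 1`), `trace S = 0`».

METHOD: pure transport.  With the frame isometry `R = ob.repr` (`CentreJet.TriaxialFrame.exists_orthonormalBasis_eq`) one has
`R (S z) = strain (e 0) (e 1) (e 2) (R z)` (`repr_strain`), `quadForm ∘ R = ⟪z, Sz⟫` (`quadForm_repr`) and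
`topField ∘ R = ε • R (S z × z)` with `ε = ±1` the orientation sign of the frame (`exists_sign_cross_map`, the cross product is a
pseudo-vector: Literature `crossProduct_mulVec_mulVec` + orthogonality of the standard matrix; `topField_repr`); the
conjugated field `B′ t y = R (B t (x₀ + R⁻¹y))` satisfies the standard-frame hypotheses by the affine-conjugation file
`ThreadingFluxErtelTowerAffineConjugation` (all operators transported unconditionally), the tree theorems apply BY NAME, and
the conclusion is pulled back along `y = R(x − x₀)`; the sign `ε` is absorbed into `C`.

BOOKING (critic's words, V21-P1/P2/P4): statements about the LINEAR STRAIN SHADOW (prescribed unbounded drift) — helpers,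
information-grade, W1 movement 0; `PotentialJerkRigidity` (CONJECTURE) untouched.  `PoloidalLiouville` (1222) / (27585) OPEN;
NS regularity NOT proved.
-/

-- the summit and its single problem share the name (D-0017 nested layout)
set_option linter.dupNamespace false

noncomputable section

namespace Summit.NavierStokesRegularity.NavierStokesRegularity.Theorems.PoloidalLiouville.ErtelTower

open Set Function
open scoped Topology RealInnerProductSpace InnerProductSpace Laplacian ContDiff Matrix
open Literature.Analysis.FluidPDE
open Summit.NavierStokesRegularity.NavierStokesRegularity.Theorems.PoloidalLiouville.HorizonTower (E3)
open Summit.NavierStokesRegularity.NavierStokesRegularity.Theorems.PoloidalLiouville.CentreJet.TriaxialFrame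
  (exists_orthonormalBasis_eq)

/-! ### Frame algebra: the eigenframe isometry `R = ob.repr` diagonalises the strain -/

section Frame

variable {S : E3 →L[ℝ] E3} {u : Fin 3 → E3} {e : Fin 3 → ℝ} {ob : OrthonormalBasis (Fin 3) ℝ E3}

/-- `τ = Sx × x` in the standard frame: the Euler-top field is the cross product of the strain drift with the position. -/
theorem topField_eq_cross (a b c : ℝ) (y : E3) : topField a b c y = cross (strain a b c y) y := by
  ext i
  fin_cases i <;> simp [topField, strain, cross, cross_apply] <;> ring

/-- **The cross product is a pseudo-vector**: for a linear isometry `R` of `ℝ³` there is a sign `ε = ±1` (the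
determinant of `R`) with `R a × R b = ε • R (a × b)` for all `a, b`.  Coordinates: `(Ma) × (Mb) = adj(M)ᵀ (a × b)` for every
`3 × 3` matrix (Literature `CommutingRotations.crossProduct_mulVec_mulVec`), and `adj(M)ᵀ = det M • M`, `det M = ±1` for the
orthogonal standard matrix `M` of `R` (Literature `toMatrixOrthonormal_transpose_mul_eq_one`). -/
theorem exists_sign_cross_map (R : E3 ≃ₗᵢ[ℝ] E3) :
    ∃ ε : ℝ, (ε = 1 ∨ ε = -1) ∧ ∀ a b : E3, cross (R a) (R b) = ε • R (cross a b) := by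
  set M : Matrix (Fin 3) (Fin 3) ℝ := LinearMap.toMatrixOrthonormal (EuclideanSpace.basisFun (Fin 3) ℝ)
    ((R : E3 →L[ℝ] E3) : E3 →ₗ[ℝ] E3) with hM
  have hMM : Mᵀ * M = 1 := toMatrixOrthonormal_transpose_mul_eq_one R
  have hdet : M.det = 1 ∨ M.det = -1 := by
    have h := congrArg Matrix.det hMM
    rw [Matrix.det_mul, Matrix.det_transpose, Matrix.det_one] at h
    have h2 : (M.det - 1) * (M.det + 1) = 0 := by linear_combination h
    rcases mul_eq_zero.mp h2 with h3 | h3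
    · exact Or.inl (by linarith)
    · exact Or.inr (by linarith)
  have hadj : (M.adjugate)ᵀ = M.det • M := by
    have h1 : M.adjugate = M.det • Mᵀ := by
      calc M.adjugate = Mᵀ * M * M.adjugate := by rw [hMM, Matrix.one_mul]
        _ = Mᵀ * (M * M.adjugate) := by rw [Matrix.mul_assoc]
        _ = M.det • Mᵀ := by rw [Matrix.mul_adjugate, Matrix.mul_smul, Matrix.mul_one]
    rw [h1, Matrix.transpose_smul, Matrix.transpose_transpose]
  have hco : ∀ w : E3, (fun k => R w k) = M *ᵥ fun k => w k := fun w =>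
    funext fun i => Literature.Analysis.Calculus.apply_apply_eq_toMatrixOrthonormal_mulVec (R : E3 →L[ℝ] E3) w i
  refine ⟨M.det, hdet, fun a b => ?_⟩
  ext i
  have hl : cross (R a) (R b) i = ((fun k => R a k) ⨯₃ (fun k => R b k)) i := rfl
  have hr : (M.det • R (cross a b)) i = M.det * (fun k => R (cross a b) k) i := rfl
  have hcab : (fun k => cross a b k) = (fun k => a k) ⨯₃ (fun k => b k) := rfl
  rw [hl, hco a, hco b, Literature.LinearAlgebra.Matrix.CommutingRotations.crossProduct_mulVec_mulVec, hadj, hr, hco,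
    hcab, Matrix.smul_mulVec, Pi.smul_apply, smul_eq_mul]

/-- Coordinates in the eigenframe: `(R z)ᵢ = ⟪uᵢ, z⟫`. -/
theorem repr_apply_eq_inner (hob : ∀ i, ob i = u i) (z : E3) (i : Fin 3) : ob.repr z i = ⟪u i, z⟫ := by
  rw [ob.repr_apply_apply, hob]

/-- The eigenframe isometry diagonalises the strain, coordinatewise: `(R (S z))ᵢ = eᵢ (R z)ᵢ`. -/
theorem repr_strain_apply (hu : Orthonormal ℝ u) (hob : ∀ i, ob i = u i) (hS : ∀ i, S (u i) = e i • u i) (z : E3)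
    (i : Fin 3) : ob.repr (S z) i = e i * ob.repr z i := by
  classical
  have hz : z = ∑ j, ob.repr z j • u j := by
    conv_lhs => rw [← ob.sum_repr z]
    simp only [hob]
  rw [repr_apply_eq_inner hob, repr_apply_eq_inner hob]
  conv_lhs => rw [hz]
  simp only [map_sum, map_smul, hS, smul_smul, inner_sum, real_inner_smul_right]
  have horth : ∀ j, ⟪u i, u j⟫ = if i = j then (1 : ℝ) else 0 := fun j => by
    rw [orthonormal_iff_ite.mp hu i j]
  simp only [horth, mul_ite, mul_one, mul_zero, Finset.sum_ite_eq, Finset.mem_univ, if_true]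
  conv_rhs => rw [hz]
  simp only [inner_sum, real_inner_smul_right, horth, mul_ite, mul_one, mul_zero, Finset.sum_ite_eq, Finset.mem_univ,
    if_true]
  ring

/-- The eigenframe isometry diagonalises the strain: `R (S z) = diag(e₀,e₁,e₂) (R z)`. -/
theorem repr_strain (hu : Orthonormal ℝ u) (hob : ∀ i, ob i = u i) (hS : ∀ i, S (u i) = e i • u i) (z : E3) :
    strain (e 0) (e 1) (e 2) (ob.repr z) = ob.repr (S z) := by
  ext i
  fin_cases i <;> simp [strain, repr_strain_apply hu hob hS]

/-- The quadratic form in the eigenframe is the intrinsic one: `quadForm (R z) = ⟪z, Sz⟫`. -/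
theorem quadForm_repr (hu : Orthonormal ℝ u) (hob : ∀ i, ob i = u i) (hS : ∀ i, S (u i) = e i • u i) (z : E3) :
    quadForm (e 0) (e 1) (e 2) (ob.repr z) = ⟪z, S z⟫ := by
  rw [← strain_dot_self, repr_strain hu hob hS, LinearIsometryEquiv.inner_map_map, real_inner_comm]

/-- The Euler-top field in the eigenframe is the intrinsic one up to the orientation sign of the frame:
`topField (R z) = ε • R (Sz × z)` whenever `cross (R a) (R b) = ε • R (cross a b)`. -/
theorem topField_repr (hu : Orthonormal ℝ u) (hob : ∀ i, ob i = u i) (hS : ∀ i, S (u i) = e i • u i) {ε : ℝ}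
    (hε : ∀ a b : E3, cross (ob.repr a) (ob.repr b) = ε • ob.repr (cross a b)) (z : E3) :
    topField (e 0) (e 1) (e 2) (ob.repr z) = ε • ob.repr (cross (S z) z) := by
  rw [topField_eq_cross, repr_strain hu hob hS, hε]

/-- Pairwise distinct principal rates, as the standard-frame Props want them. -/
theorem ne_of_injective (he : Function.Injective e) : e 0 ≠ e 1 ∧ e 1 ≠ e 2 ∧ e 2 ≠ e 0 :=
  ⟨fun h => absurd (he h) (by decide), fun h => absurd (he h) (by decide), fun h => absurd (he h) (by decide)⟩

/-- Trace-free, as the standard-frame Props want it. -/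
theorem sum_eq (htr : ∑ i, e i = 0) : e 0 + e 1 + e 2 = 0 := by
  simpa [Fin.sum_univ_three] using htr

end Frame

/-! ### The frame-free theorems -/

section FrameFree

variable (ν : ℝ) (S : E3 →L[ℝ] E3) (u : Fin 3 → E3) (e : Fin 3 → ℝ) (x₀ : E3)

/-- **INVISCID STRAIN RIGIDITY, frame-free** (`InviscidStrainRigidity` transported).  Let `S` be a strain with an
orthonormal eigenframe `u` and pairwise distinct principal rates `e`.  A smooth field `B` frozen into the drift
`x ↦ S(x − x₀)` (`∂ₜB + (S(x−x₀)·∇)B − SB = 0`) on an open `I × U` and tangent to the spheres about `x₀` vanishes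
identically — incompressible or not, trace-free or not. -/
theorem inviscidStrainRigidity_frame (B : ℝ → E3 → E3) (I : Set ℝ) (U : Set E3) (hu : Orthonormal ℝ u)
    (he : Function.Injective e) (hS : ∀ i, S (u i) = e i • u i) (hI : IsOpen I) (hU : IsOpen U)
    (hB : ContDiffOn ℝ (⊤ : ℕ∞) (uncurry B) (I ×ˢ U))
    (hpde : ∀ t ∈ I, ∀ x ∈ U, deriv (fun s => B s x) t + fderiv ℝ (B t) x (S (x - x₀)) - S (B t x) = 0)
    (htan : ∀ t ∈ I, ∀ x ∈ U, ⟪B t x, x - x₀⟫ = 0) :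
    ∀ t ∈ I, ∀ x ∈ U, B t x = 0 := by
  obtain ⟨ob, hob⟩ := exists_orthonormalBasis_eq hu
  obtain ⟨hab, hbc, hca⟩ := ne_of_injective he
  have hT : ∀ z, strain (e 0) (e 1) (e 2) (ob.repr z) = ob.repr (S z) := repr_strain hu hob hS
  have h := inviscidStrainRigidity (e 0) (e 1) (e 2) (fun t y => ob.repr (B t (x₀ + ob.repr.symm y))) I
    ((fun y => x₀ + ob.repr.symm y) ⁻¹' U) hab hbc hca hI (isOpen_affPreimage ob.repr x₀ hU)
    (contDiffOn_affConj ob.repr x₀ hB) (affConj_inviscidPDE ob.repr x₀ S _ hT hpde) (affConj_tangent ob.repr x₀ htan)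
  intro t ht x hx
  have hx' := h t ht (ob.repr (x - x₀)) ((mem_affPreimage_iff ob.repr x₀ x).mpr hx)
  rw [affChart_apply_symm] at hx'
  exact ob.repr.map_eq_zero_iff.mp hx'

/-- ★ **VISCOUS STRAIN-SHADOW CLASSIFICATION, frame-free** (`StrainShadowClassification` transported).  Let `ν > 0` and
let `S` be a TRACE-FREE strain with an orthonormal eigenframe `u` and pairwise distinct principal rates `e`, `∑ e = 0`.
Every smooth divergence-free solution of `∂ₜB + (S(x−x₀)·∇)B − SB = νΔB` on a preconnected open `I × U` that is
tangent to the spheres about `x₀` is `B(t,x) = C · exp(⟪x−x₀, S(x−x₀)⟫ / 2ν) · (S(x−x₀) × (x−x₀))` for ONE constant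
`C`: one local survivor per triaxial strain centre, steady and Gaussian-growing along every extensional axis. -/
theorem strainShadowClassification_frame (B : ℝ → E3 → E3) (I : Set ℝ) (U : Set E3) (hν : 0 < ν)
    (hu : Orthonormal ℝ u) (he : Function.Injective e) (hS : ∀ i, S (u i) = e i • u i) (htr : ∑ i, e i = 0)
    (hI : IsOpen I) (hIc : IsPreconnected I) (hU : IsOpen U) (hUc : IsPreconnected U)
    (hB : ContDiffOn ℝ (⊤ : ℕ∞) (uncurry B) (I ×ˢ U))
    (hdiv : ∀ t ∈ I, ∀ x ∈ U, VectorCalculus.divergence (B t) x = 0)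
    (hpde : ∀ t ∈ I, ∀ x ∈ U,
      deriv (fun s => B s x) t + fderiv ℝ (B t) x (S (x - x₀)) - S (B t x) = ν • (Δ (B t)) x)
    (htan : ∀ t ∈ I, ∀ x ∈ U, ⟪B t x, x - x₀⟫ = 0) :
    ∃ C : ℝ, ∀ t ∈ I, ∀ x ∈ U,
      B t x = (C * Real.exp (⟪x - x₀, S (x - x₀)⟫ / (2 * ν))) • cross (S (x - x₀)) (x - x₀) := by
  obtain ⟨ob, hob⟩ := exists_orthonormalBasis_eq hu
  obtain ⟨hab, hbc, hca⟩ := ne_of_injective he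
  obtain ⟨ε, hε1, hε⟩ := exists_sign_cross_map ob.repr
  have hT : ∀ z, strain (e 0) (e 1) (e 2) (ob.repr z) = ob.repr (S z) := repr_strain hu hob hS
  obtain ⟨C, hC⟩ := strainShadowClassification ν (e 0) (e 1) (e 2)
    (fun t y => ob.repr (B t (x₀ + ob.repr.symm y))) I ((fun y => x₀ + ob.repr.symm y) ⁻¹' U) hν hab hbc hca (sum_eq htr)
    hI hIc (isOpen_affPreimage ob.repr x₀ hU) (isPreconnected_affPreimage ob.repr x₀ hUc)
    (contDiffOn_affConj ob.repr x₀ hB) (affConj_divFree ob.repr x₀ hdiv) (affConj_strainPDE ob.repr x₀ ν S _ hT hpde)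
    (affConj_tangent ob.repr x₀ htan)
  refine ⟨ε * C, fun t ht x hx => ?_⟩
  have h := hC t ht (ob.repr (x - x₀)) ((mem_affPreimage_iff ob.repr x₀ x).mpr hx)
  rw [affChart_apply_symm, quadForm_repr hu hob hS, topField_repr hu hob hS hε, smul_smul,
    ← LinearIsometryEquiv.map_smul] at h
  rw [ob.repr.injective h]
  congr 1
  ring

/-- ★ **STRAIN-SHADOW LIOUVILLE, frame-free** (`StrainShadowLiouville` transported).  For `ν > 0` and a trace-free strain
`S` with an orthonormal eigenframe and pairwise distinct principal rates, a BOUNDED smooth divergence-free solution of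
`∂ₜB + (S(x−x₀)·∇)B − SB = νΔB` on `I × ℝ³` (`I` open preconnected) tangent to the spheres about `x₀` vanishes identically:
the bounded linear shadow of the wall at ANY triaxial stagnation centre is EMPTY. -/
theorem strainShadowLiouville_frame (B : ℝ → E3 → E3) (I : Set ℝ) (hν : 0 < ν) (hu : Orthonormal ℝ u)
    (he : Function.Injective e) (hS : ∀ i, S (u i) = e i • u i) (htr : ∑ i, e i = 0) (hI : IsOpen I)
    (hIc : IsPreconnected I) (hB : ContDiffOn ℝ (⊤ : ℕ∞) (uncurry B) (I ×ˢ univ))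
    (hdiv : ∀ t ∈ I, ∀ x, VectorCalculus.divergence (B t) x = 0)
    (hpde : ∀ t ∈ I, ∀ x, deriv (fun s => B s x) t + fderiv ℝ (B t) x (S (x - x₀)) - S (B t x) = ν • (Δ (B t)) x)
    (htan : ∀ t ∈ I, ∀ x, ⟪B t x, x - x₀⟫ = 0) (hbd : ∃ C : ℝ, ∀ t ∈ I, ∀ x, ‖B t x‖ ≤ C) :
    ∀ t ∈ I, ∀ x, B t x = 0 := by
  obtain ⟨ob, hob⟩ := exists_orthonormalBasis_eq hu
  obtain ⟨hab, hbc, hca⟩ := ne_of_injective he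
  have hT : ∀ z, strain (e 0) (e 1) (e 2) (ob.repr z) = ob.repr (S z) := repr_strain hu hob hS
  have hB' := contDiffOn_affConj ob.repr x₀ hB
  rw [affPreimage_univ] at hB'
  have h := strainShadowLiouville ν (e 0) (e 1) (e 2) (fun t y => ob.repr (B t (x₀ + ob.repr.symm y))) I hν hab hbc hca
    (sum_eq htr) hI hIc hB'
    (fun t ht y => affConj_divFree ob.repr x₀ (U := univ) (fun t ht x _ => hdiv t ht x) t ht y (mem_univ _))
    (fun t ht y => affConj_strainPDE ob.repr x₀ ν S _ hT (U := univ) (fun t ht x _ => hpde t ht x) t ht y (mem_univ _))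
    (fun t ht y => affConj_tangent ob.repr x₀ (U := univ) (fun t ht x _ => htan t ht x) t ht y (mem_univ _))
    (affConj_bounded ob.repr x₀ hbd)
  intro t ht x
  have hx' := h t ht (ob.repr (x - x₀))
  rw [affChart_apply_symm] at hx'
  exact ob.repr.map_eq_zero_iff.mp hx'

/-- **THE SURVIVOR, frame-free** (`StrainShadowSurvivor` transported, forward direction).  For `ν > 0` and a trace-free
strain `S` with an orthonormal eigenframe, EVERY member `B_C(x) = C · exp(⟪x−x₀, S(x−x₀)⟫/2ν) · (S(x−x₀) × (x−x₀))` of the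
family singled out by `strainShadowClassification_frame` is a steady solution of `(S(x−x₀)·∇)B − SB = νΔB` on all of `ℝ³`,
divergence free and tangent to the spheres about `x₀` — so in every frame nothing short of boundedness excludes the shadow. -/
theorem strainShadowSurvivor_frame (C : ℝ) (hν : 0 < ν) (hu : Orthonormal ℝ u) (hS : ∀ i, S (u i) = e i • u i)
    (htr : ∑ i, e i = 0) :
    let Bs : E3 → E3 := fun x => (C * Real.exp (⟪x - x₀, S (x - x₀)⟫ / (2 * ν))) • cross (S (x - x₀)) (x - x₀)
    (∀ x, fderiv ℝ Bs x (S (x - x₀)) - S (Bs x) = ν • (Δ Bs) x) ∧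
    (∀ x, VectorCalculus.divergence Bs x = 0) ∧ (∀ x, ⟪Bs x, x - x₀⟫ = 0) := by
  intro Bs
  obtain ⟨ob, hob⟩ := exists_orthonormalBasis_eq hu
  obtain ⟨ε, hε1, hε⟩ := exists_sign_cross_map ob.repr
  have hεsq : ε * ε = 1 := by rcases hε1 with h | h <;> simp [h]
  have hT : ∀ z, strain (e 0) (e 1) (e 2) (ob.repr z) = ob.repr (S z) := repr_strain hu hob hS
  obtain ⟨hpde, hdiv, -, -⟩ := strainShadowSurvivor ν (e 0) (e 1) (e 2) hν (sum_eq htr)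
  -- the conjugated field is `(ε C)` times the standard-frame survivor `Bd`
  have hBd_smooth : ContDiff ℝ 2
      (fun y : E3 => Real.exp (quadForm (e 0) (e 1) (e 2) y / (2 * ν)) • topField (e 0) (e 1) (e 2) y) :=
    contDiff_survivor ν (e 0) (e 1) (e 2)
  have hconj : ∀ y, ob.repr (Bs (x₀ + ob.repr.symm y)) =
      (ε * C) • (Real.exp (quadForm (e 0) (e 1) (e 2) y / (2 * ν)) • topField (e 0) (e 1) (e 2) y) := by
    intro y
    have hq := quadForm_repr hu hob hS (ob.repr.symm y)
    have hτ := topField_repr hu hob hS hε (ob.repr.symm y)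
    rw [LinearIsometryEquiv.apply_symm_apply] at hq hτ
    have hτ' : ob.repr (cross (S (ob.repr.symm y)) (ob.repr.symm y)) = ε • topField (e 0) (e 1) (e 2) y := by
      rw [hτ, smul_smul, hεsq, one_smul]
    simp only [Bs, affChart_sub, map_smul]
    rw [← hq, hτ', smul_smul, smul_smul]
    congr 1
    ring
  have hconj' : (fun y => ob.repr (Bs (x₀ + ob.repr.symm y))) =
      (ε * C) • fun y : E3 => Real.exp (quadForm (e 0) (e 1) (e 2) y / (2 * ν)) • topField (e 0) (e 1) (e 2) y :=
    funext hconj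
  -- the standard-frame survivor scaled by a constant still solves the (linear) standard-frame problem
  have hpde' : ∀ y, fderiv ℝ (fun y => ob.repr (Bs (x₀ + ob.repr.symm y))) y (strain (e 0) (e 1) (e 2) y)
      - strain (e 0) (e 1) (e 2) (ob.repr (Bs (x₀ + ob.repr.symm y)))
        = ν • (Δ (fun y => ob.repr (Bs (x₀ + ob.repr.symm y)))) y := by
    intro y
    rw [hconj y, hconj', fderiv_const_smul (hBd_smooth.differentiable (by norm_num) y),
      InnerProductSpace.laplacian_smul _ (hBd_smooth.contDiffAt (x := y)), FunLike.coe_smul,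
      Pi.smul_apply, strain_smul,
      ← smul_sub, hpde y, smul_comm]
  refine ⟨fun x => ?_, fun x => ?_, fun x => ?_⟩
  · -- the equation, pulled back along the chart (steady field: the `∂ₜ` terms are derivatives of constants)
    have key := strainShadow_affConj_iff ob.repr x₀ ν S (strain (e 0) (e 1) (e 2)) hT (fun _ => Bs) 0 (ob.repr (x - x₀))
    simp only [deriv_const, zero_add] at key
    have k2 := key.mp (hpde' _)
    rwa [affChart_apply_symm] at k2
  · have h := divergence_affConj ob.repr x₀ Bs (ob.repr (x - x₀))
    rw [affChart_apply_symm] at h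
    rw [← h, hconj']
    unfold VectorCalculus.divergence
    rw [fderiv_const_smul (hBd_smooth.differentiable (by norm_num) _), ContinuousLinearMap.toLinearMap_smul, map_smul,
      smul_eq_zero]
    exact Or.inr (hdiv _)
  · have hx : x = x₀ + ob.repr.symm (ob.repr (x - x₀)) := (affChart_apply_symm ob.repr x₀ x).symm
    rw [hx, ← inner_affConj_self ob.repr x₀, hconj, real_inner_smul_left, real_inner_smul_left, topField_tangent,
      mul_zero, mul_zero]

end FrameFree

/-! ### Intrinsic hypotheses: symmetric strain with simple spectrum -/

section Symmetric

/-- A symmetric operator on `ℝ³` all of whose eigenvalues are simple has an orthonormal eigenframe with pairwise distinct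
eigenvalues, whose sum is its trace (spectral theorem, `LinearMap.IsSymmetric.eigenvectorBasis`). -/
theorem exists_eigenframe_of_isSymmetric (S : E3 →L[ℝ] E3) (hsym : (S : E3 →ₗ[ℝ] E3).IsSymmetric)
    (hsimple : ∀ μ : ℝ, Module.finrank ℝ (Module.End.eigenspace (S : E3 →ₗ[ℝ] E3) μ) ≤ 1) :
    ∃ (u : Fin 3 → E3) (e : Fin 3 → ℝ), Orthonormal ℝ u ∧ Function.Injective e ∧ (∀ i, S (u i) = e i • u i) ∧
      ∑ i, e i = LinearMap.trace ℝ E3 (S : E3 →ₗ[ℝ] E3) := by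
  have hn : Module.finrank ℝ E3 = 3 := by simp
  set b := hsym.eigenvectorBasis hn with hbdef
  set ev : Fin 3 → ℝ := hsym.eigenvalues hn with hevdef
  have hSb : ∀ i, S (b i) = ev i • b i := fun i => hsym.apply_eigenvectorBasis hn i
  refine ⟨b, ev, b.orthonormal, fun i j hij => ?_, hSb, ?_⟩
  · -- two orthonormal eigenvectors with the same eigenvalue are independent inside a space of dimension `≤ 1`
    by_contra hne
    set p := Module.End.eigenspace (S : E3 →ₗ[ℝ] E3) (ev i) with hpdef
    have hmem : ∀ k, (b k : E3) ∈ Module.End.eigenspace (S : E3 →ₗ[ℝ] E3) (ev k) := fun k =>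
      Module.End.mem_eigenspace_iff.mpr (by rw [ContinuousLinearMap.coe_coe]; exact hSb k)
    have hli : LinearIndependent ℝ (⇑b ∘ ![i, j]) :=
      b.orthonormal.linearIndependent.comp _ (by
        intro x y hxy
        fin_cases x <;> fin_cases y
        · rfl
        · exact absurd hxy hne
        · exact absurd hxy.symm hne
        · rfl)
    have hsub : ∀ x, (⇑b ∘ ![i, j]) x ∈ p := by
      intro x
      fin_cases x
      · exact hmem i
      · show b j ∈ p
        rw [hpdef, hij]
        exact hmem j
    have hli' : LinearIndependent ℝ (fun x => (⟨(⇑b ∘ ![i, j]) x, hsub x⟩ : p)) :=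
      LinearIndependent.of_comp p.subtype hli
    have h2 := hli'.fintype_card_le_finrank
    rw [Fintype.card_fin] at h2
    exact absurd (hsimple (ev i)) (by rw [← hpdef]; omega)
  · rw [hsym.trace_eq_sum_eigenvalues hn]
    simp only [hevdef, RCLike.ofReal_real_eq_id, id_eq]

/-- ★ **STRAIN-SHADOW LIOUVILLE at a triaxial stagnation centre, intrinsic form.**  Let `ν > 0` and let `S : ℝ³ →L[ℝ] ℝ³`
be SYMMETRIC, TRACE-FREE, with SIMPLE SPECTRUM (every eigenspace has dimension `≤ 1`).  A bounded smooth divergence-free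
solution of `∂ₜB + (S(x−x₀)·∇)B − SB = νΔB` on `I × ℝ³` tangent to the spheres about `x₀` vanishes identically. -/
theorem strainShadowLiouville_symmetric (ν : ℝ) (S : E3 →L[ℝ] E3) (x₀ : E3) (B : ℝ → E3 → E3) (I : Set ℝ) (hν : 0 < ν)
    (hsym : (S : E3 →ₗ[ℝ] E3).IsSymmetric)
    (hsimple : ∀ μ : ℝ, Module.finrank ℝ (Module.End.eigenspace (S : E3 →ₗ[ℝ] E3) μ) ≤ 1)
    (htr : LinearMap.trace ℝ E3 (S : E3 →ₗ[ℝ] E3) = 0) (hI : IsOpen I) (hIc : IsPreconnected I)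
    (hB : ContDiffOn ℝ (⊤ : ℕ∞) (uncurry B) (I ×ˢ univ))
    (hdiv : ∀ t ∈ I, ∀ x, VectorCalculus.divergence (B t) x = 0)
    (hpde : ∀ t ∈ I, ∀ x, deriv (fun s => B s x) t + fderiv ℝ (B t) x (S (x - x₀)) - S (B t x) = ν • (Δ (B t)) x)
    (htan : ∀ t ∈ I, ∀ x, ⟪B t x, x - x₀⟫ = 0) (hbd : ∃ C : ℝ, ∀ t ∈ I, ∀ x, ‖B t x‖ ≤ C) :
    ∀ t ∈ I, ∀ x, B t x = 0 := by
  obtain ⟨u, e, hu, he, hS, hsum⟩ := exists_eigenframe_of_isSymmetric S hsym hsimple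
  exact strainShadowLiouville_frame ν S u e x₀ B I hν hu he hS (by rw [hsum, htr]) hI hIc hB hdiv hpde htan hbd

/-- ★ **VISCOUS STRAIN-SHADOW CLASSIFICATION at a triaxial stagnation centre, intrinsic form** (symmetric, trace-free,
simple spectrum): the solution space on every preconnected open `I × U` is the line
`C · exp(⟪x−x₀, S(x−x₀)⟫ / 2ν) · (S(x−x₀) × (x−x₀))`. -/
theorem strainShadowClassification_symmetric (ν : ℝ) (S : E3 →L[ℝ] E3) (x₀ : E3) (B : ℝ → E3 → E3) (I : Set ℝ)
    (U : Set E3) (hν : 0 < ν) (hsym : (S : E3 →ₗ[ℝ] E3).IsSymmetric)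
    (hsimple : ∀ μ : ℝ, Module.finrank ℝ (Module.End.eigenspace (S : E3 →ₗ[ℝ] E3) μ) ≤ 1)
    (htr : LinearMap.trace ℝ E3 (S : E3 →ₗ[ℝ] E3) = 0) (hI : IsOpen I) (hIc : IsPreconnected I) (hU : IsOpen U)
    (hUc : IsPreconnected U) (hB : ContDiffOn ℝ (⊤ : ℕ∞) (uncurry B) (I ×ˢ U))
    (hdiv : ∀ t ∈ I, ∀ x ∈ U, VectorCalculus.divergence (B t) x = 0)
    (hpde : ∀ t ∈ I, ∀ x ∈ U,
      deriv (fun s => B s x) t + fderiv ℝ (B t) x (S (x - x₀)) - S (B t x) = ν • (Δ (B t)) x)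
    (htan : ∀ t ∈ I, ∀ x ∈ U, ⟪B t x, x - x₀⟫ = 0) :
    ∃ C : ℝ, ∀ t ∈ I, ∀ x ∈ U,
      B t x = (C * Real.exp (⟪x - x₀, S (x - x₀)⟫ / (2 * ν))) • cross (S (x - x₀)) (x - x₀) := by
  obtain ⟨u, e, hu, he, hS, hsum⟩ := exists_eigenframe_of_isSymmetric S hsym hsimple
  exact strainShadowClassification_frame ν S u e x₀ B I U hν hu he hS (by rw [hsum, htr]) hI hIc hU hUc hB hdiv hpde htan

end Symmetric

end Summit.NavierStokesRegularity.NavierStokesRegularity.Theorems.PoloidalLiouville.ErtelTower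

end
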